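import Summits.Langlands.Langlands.Theorems.PotentialCompanionDescentBrauerTaylorDescentBrauerSolvable
import Summits.Langlands.Langlands.Theorems.PotentialCompanionDescentBrauerTaylorDescentBrauerPairing
import HarnessLib

/-!
# Brauer–Taylor descent data on `Γ` (helper for `PotentialCompanionDescent.BrauerTaylorDescent`,
# item stmt-Langlands-33718): the hypotheses `hψ`, `hB`, `hdimB` of
# `Representation.exists_irreducible_virtualBrauerDescent` for `Hᵢ = π⁻¹H̄ᵢ`, `ψᵢ = e ∘ θᵢ ∘ π`
# from Brauer's theorem in solvable form on the finite quotient `Q` (BLGGT 2014, proof of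
# Thm. 5.5.1, first paragraph).

Inflation along a surjection `π : Γ ↠ Q`: `coind_{π⁻¹S}^Γ(σ∘π) ≃ (coind_S^Q σ)∘π`
(`nonempty_equiv_coind_comap`, evaluation along a section of `π`) and
`Hom_Γ(σ∘π, τ∘π) ≃ Hom_Q(σ, τ)` (`nonempty_linearEquiv_intertwiningMap_comp`), so the pairing
count of `PotentialCompanionDescentBrauerTaylorDescentBrauerPairing` is the same on `Γ`
(`finrank_intertwiningMap_coind_comap`); `exists_brauerTaylor_descentData` packages everything.

References: [BarnetlambEtAl2014, proof of Thm. 5.5.1]; [SerreLinearRepresentations1977, §10.5].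
-/

-- `Summit.Langlands.Langlands.…` (summit = sub-problem name) trips `dupNamespace`.
set_option linter.dupNamespace false

noncomputable section

open scoped BigOperators
open Literature.RepresentationTheory.FiniteGroups Literature.RepresentationTheory.Semisimple

namespace Summit.Langlands.Langlands.Theorems.BrauerTaylorDescent

/-! ## Inflation along a surjection `π : G → Q`

For the absolute Galois group `G = Γ_K` and `Q = Gal(L/K)` one needs the data on `G`:
`Hᵢ := π⁻¹ H̄ᵢ` (open, finite index `[Q : H̄ᵢ]`), `ψᵢ := θ̃ᵢ ∘ π` (trivial on `ker π`), and
`Hom_G(coind_{Hᵢ}^G k(ψᵢ), coind_{Hⱼ}^G k(ψⱼ)) ≃ Hom_Q(coind k(θ̃ᵢ), coind k(θ̃ⱼ))`. -/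

section Inflation

variable {k : Type} [Field k] {Γ Q : Type} [Group Γ] [Group Q] (π : Γ →* Q)
  (hπ : Function.Surjective π)

/-- A function in `coind_{π⁻¹S}^Γ (σ ∘ π)` is constant on the fibres of `π`. [folklore] -/
theorem coindV_comap_apply_eq_of_apply_eq (S : Subgroup Q) {A : Type} [AddCommGroup A]
    [Module k A] (σ : Representation k S A)
    (f : Representation.coindV (S.comap π).subtype (σ.comp (π.subgroupComap S)))
    {g g' : Γ} (h : π g = π g') : (f : Γ → A) g = (f : Γ → A) g' := by
  have hm : g' * g⁻¹ ∈ S.comap π := by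
    rw [Subgroup.mem_comap, map_mul, map_inv, ← h, mul_inv_cancel]; exact S.one_mem
  have := (Representation.mem_coindV _ _ _).1 f.2 ⟨g' * g⁻¹, hm⟩ g
  rw [Subgroup.coe_subtype, inv_mul_cancel_right] at this
  rw [this]
  have h1 : π.subgroupComap S ⟨g' * g⁻¹, hm⟩ = 1 := by
    ext1
    simp only [MonoidHom.subgroupComap_apply_coe, map_mul, map_inv, ← h, mul_inv_cancel,
      Subgroup.coe_one]
  rw [MonoidHom.comp_apply, h1, map_one, Module.End.one_apply]

include hπ in
/-- **Coinduction commutes with inflation**: for `π : Γ ↠ Q`, `S ≤ Q` and a representation `σ`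
of `S`, `coind_{π⁻¹S}^Γ (σ ∘ π) ≃ (coind_S^Q σ) ∘ π` (evaluate along a section of `π`).
[folklore] -/
theorem nonempty_equiv_coind_comap (S : Subgroup Q) {A : Type} [AddCommGroup A] [Module k A]
    (σ : Representation k S A) :
    Nonempty (Representation.Equiv
      (Representation.coind (S.comap π).subtype (σ.comp (π.subgroupComap S)))
      ((Representation.coind S.subtype σ).comp π)) := by
  classical
  let s : Q → Γ := Function.surjInv hπ
  have hs : ∀ q, π (s q) = q := Function.surjInv_eq hπ
  -- forward and backward linear maps
  let fwd : Representation.coindV (S.comap π).subtype (σ.comp (π.subgroupComap S)) →ₗ[k]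
      Representation.coindV S.subtype σ :=
    { toFun := fun f => ⟨fun q => (f : Γ → A) (s q), by
        rw [Representation.mem_coindV]
        intro t q
        have hmem : s (t : Q) ∈ S.comap π := by rw [Subgroup.mem_comap, hs]; exact t.2
        have h1 := coindV_comap_apply_eq_of_apply_eq π S σ f
          (g := s ((t : Q) * q)) (g' := s t * s q) (by rw [map_mul, hs, hs, hs])
        have h2 := (Representation.mem_coindV _ _ _).1 f.2 ⟨s t, hmem⟩ (s q)
        rw [Subgroup.coe_subtype] at h2
        rw [Subgroup.coe_subtype, h1, h2, MonoidHom.comp_apply]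
        congr 2
        ext1
        simp only [MonoidHom.subgroupComap_apply_coe, hs]⟩
      map_add' := fun f f' => by ext q; rfl
      map_smul' := fun c f => by ext q; rfl }
  let bwd : Representation.coindV S.subtype σ →ₗ[k]
      Representation.coindV (S.comap π).subtype (σ.comp (π.subgroupComap S)) :=
    { toFun := fun f => ⟨fun g => (f : Q → A) (π g), by
        rw [Representation.mem_coindV]
        intro t g
        have := (Representation.mem_coindV _ _ _).1 f.2 (π.subgroupComap S t) (π g)
        rw [Subgroup.coe_subtype, MonoidHom.subgroupComap_apply_coe] at this
        rw [Subgroup.coe_subtype, map_mul, this, MonoidHom.comp_apply]⟩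
      map_add' := fun f f' => by ext g; rfl
      map_smul' := fun c f => by ext g; rfl }
  refine ⟨Representation.Equiv.mk
    { toLinearMap := fwd
      invFun := bwd
      left_inv := fun f => by
        ext g
        exact coindV_comap_apply_eq_of_apply_eq π S σ f (hs (π g))
      right_inv := fun f => by
        ext q
        show (f : Q → A) (π (s q)) = (f : Q → A) q
        rw [hs] } fun x => ?_⟩
  ext f q
  show (((Representation.coind (S.comap π).subtype (σ.comp (π.subgroupComap S))) x f :
      Representation.coindV _ _) : Γ → A) (s q) =
    (f : Γ → A) (s (q * π x))
  rw [Representation.coind_apply]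
  exact coindV_comap_apply_eq_of_apply_eq π S σ f (by rw [map_mul, hs, hs])

include hπ in
/-- `Hom_Γ(σ ∘ π, τ ∘ π) ≃ Hom_Q(σ, τ)` for a surjection `π : Γ ↠ Q`. [folklore] -/
theorem nonempty_linearEquiv_intertwiningMap_comp {A B : Type} [AddCommGroup A] [Module k A]
    [AddCommGroup B] [Module k B] (σ : Representation k Q A) (τ : Representation k Q B) :
    Nonempty (Representation.IntertwiningMap (σ.comp π) (τ.comp π) ≃ₗ[k]
      Representation.IntertwiningMap σ τ) :=
  ⟨{ toFun := fun f => ⟨f.toLinearMap, fun q => by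
        obtain ⟨g, rfl⟩ := hπ q
        exact f.isIntertwining' g⟩
     invFun := fun f => ⟨f.toLinearMap, fun g => f.isIntertwining' (π g)⟩
     left_inv := fun f => rfl
     right_inv := fun f => rfl
     map_add' := fun f f' => rfl
     map_smul' := fun c f => rfl }⟩

include hπ in
/-- Inflated pairing: `dim Hom_Γ(coind_{π⁻¹S}(α∘π), coind_{π⁻¹T}(β∘π)) = dim Hom_Q(coind α, coind β)`.
[folklore] -/
theorem finrank_intertwiningMap_coind_comap (S T : Subgroup Q) (α : S →* kˣ) (β : T →* kˣ) :
    Module.finrank k (Representation.IntertwiningMap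
        (Representation.coind (S.comap π).subtype
          (Representation.ofChar (α.comp (π.subgroupComap S))))
        (Representation.coind (T.comap π).subtype
          (Representation.ofChar (β.comp (π.subgroupComap T))))) =
      Module.finrank k (Representation.IntertwiningMap
        (Representation.coind S.subtype (Representation.ofChar α))
        (Representation.coind T.subtype (Representation.ofChar β))) := by
  obtain ⟨eS⟩ := nonempty_equiv_coind_comap π hπ S (Representation.ofChar (k := k) α)
  obtain ⟨eT⟩ := nonempty_equiv_coind_comap π hπ T (Representation.ofChar (k := k) β)
  obtain ⟨eH⟩ := nonempty_linearEquiv_intertwiningMap_comp π hπ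
    (Representation.coind S.subtype (Representation.ofChar (k := k) α))
    (Representation.coind T.subtype (Representation.ofChar (k := k) β))
  have h1 : (Representation.ofChar (α.comp (π.subgroupComap S)) : Representation k (S.comap π) k)
      = (Representation.ofChar α).comp (π.subgroupComap S) := MonoidHom.ext fun _ => rfl
  have h2 : (Representation.ofChar (β.comp (π.subgroupComap T)) : Representation k (T.comap π) k)
      = (Representation.ofChar β).comp (π.subgroupComap T) := MonoidHom.ext fun _ => rfl
  rw [h1, h2, (Representation.IntertwiningMap.congrLeft eS _).finrank_eq,
    (Representation.IntertwiningMap.congrRight _ eT).finrank_eq, eH.finrank_eq]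

end Inflation

/-! ## The Brauer–Taylor descent data on `Γ` -/

/-- **Brauer–Taylor descent data** (the "Brauer half" of BLGGT 2014, proof of Thm. 5.5.1, in
the shape consumed by `Representation.exists_irreducible_virtualBrauerDescent`): for a surjection
`π : Γ ↠ Q` onto a finite group and a ring homomorphism `e : ℂ →+* k` into an algebraically closed
field there are SOLVABLE subgroups `H̄ᵢ ≤ Q`, degree-one characters `θᵢ : H̄ᵢ →* ℂˣ` and integers
`nᵢ` with
* `∑ᵢ nᵢ Ind_{H̄ᵢ}^Q θᵢ = 1` (Brauer, solvable form);
* `∑ᵢ nᵢ [Γ : π⁻¹H̄ᵢ] = 1` (`hdimB`);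
* the inflated characters `ψᵢ = e ∘ θᵢ ∘ π : π⁻¹H̄ᵢ →* kˣ` are trivial on `ker π` (`hψ`);
* `∑_{i,j} nᵢ nⱼ dim_k Hom_Γ(coind_{π⁻¹H̄ᵢ}^Γ k(ψᵢ), coind_{π⁻¹H̄ⱼ}^Γ k(ψⱼ)) = 1` (`hB`).
[cite: BarnetlambEtAl2014, proof of Thm. 5.5.1] [cite: SerreLinearRepresentations1977, §10.5 Thm. 20] -/
theorem exists_brauerTaylor_descentData {Γ Q : Type} [Group Γ] [Group Q] [Fintype Q]
    (π : Γ →* Q) (hπ : Function.Surjective π) (k : Type) [Field k] [IsAlgClosed k]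
    (e : ℂ →+* k) :
    ∃ (ι : Type) (_ : Fintype ι) (H : ι → Subgroup Q) (θ : ∀ i, H i →* ℂˣ) (n : ι → ℤ),
      (∀ i, IsSolvable (H i)) ∧
      (∀ s : Q, ∑ i, (n i : ℂ) * indClassFun (H i) (fun h => ((θ i h : ℂˣ) : ℂ)) s = 1) ∧
      (∑ i, n i * (((H i).comap π).index : ℤ) = 1) ∧
      (∀ i (h : (H i).comap π), π h = 1 →
        (((Units.map (e : ℂ →* k)).comp (θ i)).comp (π.subgroupComap (H i))) h = 1) ∧
      (∑ i, ∑ j, n i * n j * (Module.finrank k (Representation.IntertwiningMap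
        (Representation.coind ((H i).comap π).subtype (Representation.ofChar
          (((Units.map (e : ℂ →* k)).comp (θ i)).comp (π.subgroupComap (H i)))))
        (Representation.coind ((H j).comap π).subtype (Representation.ofChar
          (((Units.map (e : ℂ →* k)).comp (θ j)).comp (π.subgroupComap (H j)))))) : ℤ)) = 1 := by
  obtain ⟨ι, hι, H, θ, n, hsolv, hB⟩ := exists_brauer_solvable_one Q
  refine ⟨ι, hι, H, θ, n, hsolv, hB, ?_, ?_, ?_⟩
  · simp_rw [Subgroup.index_comap_of_surjective _ hπ]
    exact sum_mul_index_eq_one H θ n hB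
  · intro i h h1
    have : π.subgroupComap (H i) h = 1 := by ext1; simpa using h1
    rw [MonoidHom.comp_apply, this, map_one]
  · simp_rw [finrank_intertwiningMap_coind_comap π hπ]
    exact sum_sum_finrank_intertwiningMap_coind_ofChar_eq_one e H θ n hB

end Summit.Langlands.Langlands.Theorems.BrauerTaylorDescent

end
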